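import Summits.QuantumFields.YangMills.Theorems.UnitScaleTiltProp8ChartDefs
import HarnessLib

/-!
# Route `UnitScaleTilt`, crux K1 «MinimiserStabilityRegPr» (stmt-QuantumFields-19200), leaf V2′ `stub_halvingStep` — pillar P3 `ChartPerLevel`:
# **GAUGE COVARIANCE OF THE UNGUARDED (0.4) AVERAGE AND OF ITS ITERATE ON `𝔸ˣ`-VALUED FIELDS** ([Balaban1985Averaging] (11) «`Ū^u = (Ū)^{u∘emb}`»,
# [Balaban1987RG1] (0.6), for the analytic continuation `Prop8Chart.emlAvgU` of the family's averaging)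

Cell `ym3-torus` ∕ fleet seat `ym-ust-19200-p2` g6 (v8 PEN).  The tree has the covariance of the GUARDED `SU(N)` average (`BlockAveraging.avgFun_covariant`,
through `GaugeGroup`-valued `holAt`).  The chart of pillar P3 lives on configurations in the units `𝔸ˣ` of a complete normed `ℂ`-algebra (`M₂(ℂ)ˣ` at the
carrier: the complexified fields `e^{iηA}` of [Balaban1985Variational] (152)), averaged by the UNGUARDED `emlAvgU` (p535818).  This file proves its covariance
under ARBITRARY gauge transformations `u : T^{(j)} → 𝔸ˣ` (no unitarity, no smallness — `log` and `exp` commute with conjugation, `ExpMeanLog.eml_conj`):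
* §1 `holT_gaugeActT` — transports of `V^u` are conjugated transports, `V^u(Γ_{x→x′}) = u(x)·V(Γ)·u(x′)⁻¹` (any group);
* §2 `loopHolU_gaugeActT` (the (0.4) loops are closed: conjugation by `u(emb c₋)`), **`emlAvgU_gaugeActT`**: `emlAvgU (V^u) = (emlAvgU V)^{u ∘ emb}`;
* §3 **`emlIterU_gaugeActT`**: `Ū^{(k)}(V^u) = (Ū^{(k)}V)^{u_k}` for every family `u_{i+1} = u_i ∘ emb`, `u₀ = u` (characterised, not defined), and the
  pure-gauge corollary `emlIterU_pureGauge` (`Ū^{(k)}` of a pure gauge `1^u` is the pure gauge `1^{u_k}`).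
WHY (the k-uniform engine of P3, recorded for the lineage): covariance is what lets the multi-level smallness of `Ū^{(i)}(e^{iηA})` on the weighted ball be
propagated in the FACTORISED form `Ū^{(i)} = S_i^{H_i}` with a «straight» part `S_i` (size `×L` per level) and a coarse gauge `H_i` collecting the comb means —
the nonlinear twin of `Q^{(k)} = L^k·Q_k − dΛ_k` (p522364) — instead of the lossy sup-norm recursion.  Sorry-free, definition-free.  NOT a claim about the mass gap.

References: T. Bałaban, CMP **98** (1985) 17–51 [Balaban1985Averaging] ((8)–(11) pp.18–19); CMP **109** (1987) 249–301 [Balaban1987RG1] ((0.4)–(0.6) p.253).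
-/

noncomputable section

open scoped BigOperators

namespace Summit.QuantumFields.YangMills.Theorems.Prop8Chart

open Literature.MathematicalPhysics.QuantumFieldTheory.Balaban1983to89
open T4Continuum BlockAveraging ExpMeanLog MatrixLog
open B10Eq27TorusAxialLog (holT holT_nil holT_cons_true holT_cons_false holT_one gaugeActT gaugeActT_apply)

variable {P : Params} {j : ℕ}

/-! ## §1 Transports of a gauge-transformed field -/

section Transport

variable {G : Type*} [Group G]

/-- **`V^u(Γ_{x → x′}) = u(x)·V(Γ)·u(x′)⁻¹`**: the transport of the gauge-transformed field `V^u(b) = u(b₋)V(b)u(b₊)⁻¹` along the walk spelled by `w` from `x`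
is the transport of `V` conjugated by `u` at the two ends (telescoping; any group). [cite: Balaban1985Averaging, (8)-(9) pp.18-19] -/
theorem holT_gaugeActT (u : GaugeTransf P j G) (V : GaugeField P j G) :
    ∀ (w : List (Letter P.d)) (x : Site P j), holT (gaugeActT u V) x w = u x * holT V x w * (u (walkEnd x w))⁻¹
  | [], x => by simp [holT_nil, walkEnd]
  | (μ, true) :: w, x => by
    rw [holT_cons_true, holT_cons_true, holT_gaugeActT u V w (x.shift μ), gaugeActT_apply]
    simp only [walkEnd, PBond.tgt, mul_assoc, inv_mul_cancel_left]
  | (μ, false) :: w, x => by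
    rw [holT_cons_false, holT_cons_false, holT_gaugeActT u V w (x.unshift μ), gaugeActT_apply]
    simp only [walkEnd, PBond.tgt, Site.shift_unshift, mul_inv_rev, inv_inv, mul_assoc, inv_mul_cancel_left]

/-- Along a CLOSED walk the transport of `V^u` is the transport of `V` conjugated by `u` at the base. [cite: Balaban1985Averaging, (8)-(9) pp.18-19] -/
theorem holT_gaugeActT_closed (u : GaugeTransf P j G) (V : GaugeField P j G) (x : Site P j) {w : List (Letter P.d)}
    (hw : ∀ ν, ((netDisp w ν : ℤ) : ZMod (P.sitesPerDir j)) = 0) :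
    holT (gaugeActT u V) x w = u x * holT V x w * (u x)⁻¹ := by
  rw [holT_gaugeActT, walkEnd_eq_self_of_netDisp hw]

end Transport

/-! ## §2 The unguarded (0.4) average -/

section Avg

variable {𝔸 : Type*} [NormedRing 𝔸] [NormedAlgebra ℂ 𝔸] [CompleteSpace 𝔸]

omit [NormedAlgebra ℂ 𝔸] [CompleteSpace 𝔸] in
/-- The (0.4) loop variables of `V^u` at `c` are those of `V` conjugated by `u(emb c₋)` (the loop words are closed). [cite: Balaban1987RG1, (0.4) p.253] -/
theorem loopHolU_gaugeActT (u : GaugeTransf P j 𝔸ˣ) (V : GaugeField P j 𝔸ˣ) (c : PBond P (j + 1)) (i : Idx P) :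
    loopHolU (gaugeActT u V) c i = u (emb c.src) * loopHolU V c i * (u (emb c.src))⁻¹ := by
  unfold loopHolU
  exact holT_gaugeActT_closed u V (emb c.src) fun ν => by rw [netDisp_loopWord, Int.cast_zero]

/-- **COVARIANCE OF THE UNGUARDED (0.4) AVERAGE**: `emlAvgU (V^u) = (emlAvgU V)^{u ∘ emb}` for EVERY gauge transformation `u : T^{(j)} → 𝔸ˣ` — the loops
conjugate by `u(emb c₋)`, `exp[mean log]` commutes with conjugation ((0.6), `ExpMeanLog.eml_conj`), and the straight transporter of `c` picks up `u(emb c₋)`,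
`u(emb c₊)⁻¹` at its ends. [cite: Balaban1985Averaging, (11) p.19; Balaban1987RG1, (0.6) p.253] -/
theorem emlAvgU_gaugeActT (u : GaugeTransf P j 𝔸ˣ) (V : GaugeField P j 𝔸ˣ) :
    emlAvgU (gaugeActT u V) = gaugeActT (fun y : Site P (j + 1) => u (emb y)) (emlAvgU V) := by
  funext c
  apply Units.ext
  rw [gaugeActT_apply, coe_emlAvgU, Units.val_mul, Units.val_mul, coe_emlAvgU]
  -- the loops
  have hloop : (fun i : Idx P => ((loopHolU (gaugeActT u V) c i : 𝔸ˣ) : 𝔸)) =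
      fun i => ((u (emb c.src) : 𝔸ˣ) : 𝔸) * ((loopHolU V c i : 𝔸ˣ) : 𝔸) * (((u (emb c.src))⁻¹ : 𝔸ˣ) : 𝔸) := by
    funext i; rw [loopHolU_gaugeActT, Units.val_mul, Units.val_mul]
  rw [hloop, eml_conj (Units.mul_inv _) (Units.inv_mul _)]
  -- the straight transporter
  rw [holT_gaugeActT, walkEnd_replicate_L, Units.val_mul, Units.val_mul]
  -- `u·E·u⁻¹ · u·S·u′⁻¹ = u·(E·S)·u′⁻¹`
  simp only [mul_assoc, Units.inv_mul_cancel_left]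
  rfl

/-- In particular the average of a PURE GAUGE `1^u` is the pure gauge `1^{u∘emb}`. [cite: Balaban1985Averaging, (11) p.19] -/
theorem emlAvgU_pureGauge (u : GaugeTransf P j 𝔸ˣ) :
    emlAvgU (gaugeActT u (fun _ : PBond P j => (1 : 𝔸ˣ))) = gaugeActT (fun y : Site P (j + 1) => u (emb y)) (fun _ => 1) := by
  rw [emlAvgU_gaugeActT, emlAvgU_one]

end Avg

/-! ## §3 The iterate -/

section Iter

variable {𝔸 : Type*} [NormedRing 𝔸] [NormedAlgebra ℂ 𝔸] [CompleteSpace 𝔸]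

/-- **COVARIANCE OF THE `k`-FOLD UNGUARDED AVERAGE**: for every family of gauge transformations `us i : T^{(i)} → 𝔸ˣ` with `us (i+1) y = us i (emb y)` (the
finest one read at the iterated block centres), `Ū^{(k)}(V^{us 0}) = (Ū^{(k)} V)^{us k}`. [cite: Balaban1985Averaging, (11) p.19; Balaban1987RG1, (0.11) p.253] -/
theorem emlIterU_gaugeActT (us : (i : ℕ) → GaugeTransf P i 𝔸ˣ) (hus : ∀ (i : ℕ) (y : Site P (i + 1)), us (i + 1) y = us i (emb y))
    (V : GaugeField P 0 𝔸ˣ) : ∀ k : ℕ, emlIterU k (gaugeActT (us 0) V) = gaugeActT (us k) (emlIterU k V)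
  | 0 => by rw [emlIterU_zero, emlIterU_zero]
  | k + 1 => by
    rw [emlIterU_succ, emlIterU_succ, emlIterU_gaugeActT us hus V k, emlAvgU_gaugeActT]
    congr 1
    funext y
    exact (hus k y).symm

/-- The `k`-fold average of a pure gauge is a pure gauge. [cite: Balaban1985Averaging, (11) p.19] -/
theorem emlIterU_pureGauge (us : (i : ℕ) → GaugeTransf P i 𝔸ˣ) (hus : ∀ (i : ℕ) (y : Site P (i + 1)), us (i + 1) y = us i (emb y)) (k : ℕ) :
    emlIterU k (gaugeActT (us 0) (fun _ : PBond P 0 => (1 : 𝔸ˣ))) = gaugeActT (us k) (fun _ => 1) := by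
  rw [emlIterU_gaugeActT us hus, emlIterU_one]

/-- **FACTORISED FIELDS AVERAGE FACTORISED**: if `U = S^{H}` on the whole lattice (`U(b) = H(b₋)S(b)H(b₊)⁻¹`), then `emlAvgU U = (emlAvgU S)^{H∘emb}` — the form
in which the multi-level smallness of the chart is propagated (straight part `S`, coarse gauge `H`). [cite: Balaban1985Averaging, (11) p.19] -/
theorem emlAvgU_eq_gaugeActT_of_eq {U S : GaugeField P j 𝔸ˣ} {H : GaugeTransf P j 𝔸ˣ} (h : U = gaugeActT H S) :
    emlAvgU U = gaugeActT (fun y : Site P (j + 1) => H (emb y)) (emlAvgU S) := by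
  rw [h, emlAvgU_gaugeActT]

end Iter

end Summit.QuantumFields.YangMills.Theorems.Prop8Chart

end
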